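import Literature.AlgebraicGeometry.Resolution.GenericFormSimpleZeros
import Literature.AlgebraicGeometry.Resolution.SmoothFibreChart
import HarnessLib

/-!
# The fibre of a locally principal closed subscheme over a point is reduced when its local equations are local parameters of the fibre

Topic: `Literature/AlgebraicGeometry/Resolution`. Pure proofs (no definition, no named fact) of
the step "`H ∩ f⁻¹(y)` is a reduced scheme" in de Jong's proof of his multisection lemma
(de Jong 1996, Lemma 4.13, p. 70: "`U = {H ∈ 𝐏^∨ | …, H ∩ f⁻¹(y) is a reduced scheme}`. Here
`f⁻¹(y)` denotes the scheme-theoretic fibre"), in the chart-wise form in which the generic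
choice of the hypersurface (`GenericFormSimpleZeros.lean`: the chart value `g` of a generic form
`LocallyGenerates` the maximal ideal of the affine ring `A/𝔫A` of the fibre at each of its zeros)
produces it:

* `exists_chart_subscheme_of_ideal_eq_span` — the affine chart
  `Spec (Γ(X, W)/(h)) ↪ V(I)` of the closed subscheme `V(I)` over an affine open `W` on which
  `I` is generated by `h`, through a given point, with its two compatibilities
  (with `V(I) ↪ X` and with `V(I) ↪ X → Y` over an affine `U ⊇ f(W)`); this packages the chart
  used in `AlterationsMultisectionEtaleNhdChart.lean`;
* `isField_locQuot_of_locallyGenerates` — the algebra: if the class of `h` locally generates the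
  prime `𝔮/𝔫A` of `A/𝔫A`, then `(A/(h))_𝔔 / 𝔫 (A/(h))_𝔔` is a field (`𝔔 = 𝔮/(h)`);
* **`isReduced_fiber_subschemeι_comp_of_locallyGenerates`** — if every point `x` of
  `V(I) ∩ f⁻¹(y)` has such a chart (`W ∋ x` affine inside `f⁻¹(U)`, `U ∋ y` affine,
  `I|_W = (h)`, and `h̄` locally generates `𝔭_x/𝔫A` in `A/𝔫A`, `𝔫` the prime of `y`), then the
  scheme-theoretic fibre of `V(I) ↪ X → Y` over `y` is reduced: its local ring at the point over
  `x` is `𝒪_{V(I),x}/𝔪_y ≅ (A/(h))_𝔔/𝔫 (A/(h))_𝔔` (`Motives.nonempty_stalkFiber_ringEquiv`,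
  `nonempty_stalkQuot_ringEquiv_of_chart`), a field.

## References

* A. J. de Jong, *Smoothness, semi-stability and alterations*, Publ. Math. IHÉS 83 (1996),
  Lemma 4.13 (proof), p. 70. [DeJong1996]
-/

noncomputable section

universe u

open CategoryTheory CategoryTheory.Limits AlgebraicGeometry TopologicalSpace Topology IsLocalRing

namespace Literature.AlgebraicGeometry.Resolution

/-! ### Algebra: the local ring of the fibre of `V(h)` at a simple zero is a field -/

section Algebra

variable {A : Type u} [CommRing A]

/-- **`(A/(h))_𝔔 / 𝔫(A/(h))_𝔔` is a field when `h̄` locally generates `𝔮/𝔫A ⊆ A/𝔫A`.**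
Let `N ⊆ A` be an ideal (the extension `𝔫A` of the prime of the base point), `h ∈ A`,
`𝔔` a prime of `A/(h)` containing the image of `N`, and `𝔮 ⊆ A` its preimage. If the class of
`h` in `A/N` generates the prime `𝔮/N` locally (`LocallyGenerates`: every element of `𝔮/N`
becomes a multiple of `h̄` after multiplication by an element outside `𝔮/N`), then the maximal
ideal of `(A/(h))_𝔔` is the extension of `N`, so the quotient is a field — the algebra of
"`H` is defined by `(h) ⊂ 𝒪_{X,x}` with `h̄ ∉ 𝔪²_{x,f⁻¹(y)}`, as `H ∩ f⁻¹(y)` [is reduced]" read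
backwards (de Jong 1996, proof of 4.13, p. 70). [cite: DeJong1996, Lemma 4.13 (proof), p. 70] -/
theorem isField_locQuot_of_locallyGenerates (N : Ideal A) (h : A)
    (𝔔 : Ideal (A ⧸ Ideal.span {h})) [𝔔.IsPrime]
    (hN : N.map (Ideal.Quotient.mk (Ideal.span {h})) ≤ 𝔔)
    (hloc : LocallyGenerates ((𝔔.comap (Ideal.Quotient.mk (Ideal.span {h}))).map
      (Ideal.Quotient.mk N)) (Ideal.Quotient.mk N h)) :
    IsField (Localization.AtPrime 𝔔 ⧸
      N.map ((algebraMap (A ⧸ Ideal.span {h}) (Localization.AtPrime 𝔔)).comp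
        (Ideal.Quotient.mk (Ideal.span {h})))) := by
  set mk := Ideal.Quotient.mk (Ideal.span {h}) with hmk
  set L := Localization.AtPrime 𝔔 with hL
  set J : Ideal L := N.map ((algebraMap (A ⧸ Ideal.span {h}) L).comp mk) with hJ
  have hJ' : J = (N.map mk).map (algebraMap (A ⧸ Ideal.span {h}) L) := by
    rw [hJ, Ideal.map_map]
  -- `J ⊆ 𝔔 L = 𝔪_L`
  have hJle : J ≤ maximalIdeal L := by
    rw [hJ', ← Localization.AtPrime.map_eq_maximalIdeal]
    exact Ideal.map_mono hN
  -- `𝔪_L ⊆ J`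
  have hle : maximalIdeal L ≤ J := by
    rw [← Localization.AtPrime.map_eq_maximalIdeal, Ideal.map_le_iff_le_comap]
    intro t ht
    obtain ⟨d, rfl⟩ := Ideal.Quotient.mk_surjective t
    -- `d ∈ 𝔮`, so `s d ∈ (h) + N` for some `s ∉ 𝔮`
    have hd : Ideal.Quotient.mk N d ∈ (𝔔.comap mk).map (Ideal.Quotient.mk N) :=
      Ideal.mem_map_of_mem _ (show d ∈ 𝔔.comap mk from ht)
    obtain ⟨sbar, hs, hsd⟩ := hloc _ hd
    obtain ⟨s, rfl⟩ := Ideal.Quotient.mk_surjective sbar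
    have hs' : s ∉ 𝔔.comap mk := fun h' => hs (Ideal.mem_map_of_mem _ h')
    obtain ⟨rbar, hr⟩ := Ideal.mem_span_singleton'.mp hsd
    obtain ⟨r, rfl⟩ := Ideal.Quotient.mk_surjective rbar
    -- `s d - r h ∈ N`
    have hsdN : s * d - r * h ∈ N := by
      rw [← Ideal.Quotient.eq_zero_iff_mem, map_sub, map_mul, map_mul, ← hr, sub_self]
    -- in `A/(h)`: `mk s * mk d ∈ N (A/(h))`
    have hmem : mk s * mk d ∈ N.map mk := by
      have h1 : mk (s * d - r * h) ∈ N.map mk := Ideal.mem_map_of_mem _ hsdN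
      have h2 : mk (r * h) = 0 := by
        rw [hmk, Ideal.Quotient.eq_zero_iff_mem]
        exact Ideal.mul_mem_left _ _ (Ideal.mem_span_singleton_self h)
      rw [map_sub, h2, sub_zero, map_mul] at h1
      exact h1
    -- in `L`: `mk s` becomes a unit
    have hunit : IsUnit (algebraMap (A ⧸ Ideal.span {h}) L (mk s)) :=
      IsLocalization.map_units L ⟨mk s, show mk s ∈ 𝔔.primeCompl from hs'⟩
    have h3 : algebraMap _ L (mk s) * algebraMap _ L (mk d) ∈ J := by
      rw [← map_mul, hJ']
      exact Ideal.mem_map_of_mem _ hmem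
    rw [Ideal.mem_comap]
    exact (Ideal.unit_mul_mem_iff_mem J hunit).mp h3
  have hJeq : J = maximalIdeal L := le_antisymm hJle hle
  rw [← Ideal.Quotient.maximal_ideal_iff_isField_quotient, hJeq]
  infer_instance

end Algebra

/-! ### The affine chart of a locally principal closed subscheme through a point -/

section Chart

variable {X Y : Scheme.{u}} (f : X ⟶ Y) {U : Y.Opens} (hU : IsAffineOpen U) {W : X.Opens}
  (hW : IsAffineOpen W) (hWU : W ≤ f ⁻¹ᵁ U) (I : X.IdealSheafData)

/-- **The chart `Spec (Γ(X, W)/(h)) ↪ V(I)` through a point.** Let `I` be an ideal sheaf on `X`,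
`W = Spec A` an affine open on which `I` is generated by `h ∈ A`, `W ⊆ f⁻¹(U)` for an affine open
`U` of `Y`, and `x̂` a point of `V(I)` lying in `W`. Then the canonical open immersion
`c : Spec (A/(h)) ↪ V(I)` (Mathlib `IdealSheafData.subschemeCover`) passes through `x̂`, and
`c ≫ (V(I) ↪ X) = Spec (A → A/(h)) ≫ (Spec A ↪ X)`,
`c ≫ (V(I) ↪ X → Y) = Spec (Γ(Y, U) → A → A/(h)) ≫ (Spec Γ(Y, U) ↪ Y)` — the chart on which
de Jong's local analysis of `f|_H : H → Y` at the points of `H ∩ f⁻¹(y)` runs (proof of 4.13,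
p. 70; cf. `exists_opens_etale_subschemeι_comp`). [cite: DeJong1996, Lemma 4.13 (proof), p. 70] -/
theorem exists_chart_subscheme_of_ideal_eq_span {h : Γ(X, W)}
    (hIW : I.ideal ⟨W, hW⟩ = Ideal.span {h}) (xh : I.subscheme) (hxW : I.subschemeι xh ∈ W) :
    ∃ (c : Spec (CommRingCat.of (Γ(X, W) ⧸ Ideal.span {h})) ⟶ I.subscheme)
      (_ : IsOpenImmersion c) (p : Spec (CommRingCat.of (Γ(X, W) ⧸ Ideal.span {h}))),
      c p = xh ∧
      c ≫ I.subschemeι =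
        Spec.map (CommRingCat.ofHom (Ideal.Quotient.mk (Ideal.span {h}))) ≫ hW.fromSpec ∧
      c ≫ (I.subschemeι ≫ f) =
        Spec.map (f.appLE U W hWU ≫ CommRingCat.ofHom (Ideal.Quotient.mk (Ideal.span {h}))) ≫
          hU.fromSpec := by
  let eIso : CommRingCat.of (Γ(X, W) ⧸ I.ideal ⟨W, hW⟩) ≅
      CommRingCat.of (Γ(X, W) ⧸ Ideal.span {h}) :=
    (Ideal.quotEquivOfEq hIW).toCommRingCatIso
  let c : Spec (CommRingCat.of (Γ(X, W) ⧸ Ideal.span {h})) ⟶ I.subscheme :=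
    Spec.map eIso.hom ≫ I.subschemeCover.f ⟨W, hW⟩
  have hmk : CommRingCat.ofHom (Ideal.Quotient.mk (I.ideal ⟨W, hW⟩)) ≫ eIso.hom =
      CommRingCat.ofHom (Ideal.Quotient.mk (Ideal.span {h})) := by
    ext b
    simp [eIso]
  have hcι : c ≫ I.subschemeι =
      Spec.map (CommRingCat.ofHom (Ideal.Quotient.mk (Ideal.span {h}))) ≫ hW.fromSpec := by
    simp only [c, Category.assoc]
    erw [Scheme.IdealSheafData.subschemeCover_map_subschemeι, Scheme.IdealSheafData.glueDataObjι_ι]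
    rw [← Category.assoc, ← Spec.map_comp, hmk]
  have hc : c ≫ (I.subschemeι ≫ f) =
      Spec.map (f.appLE U W hWU ≫ CommRingCat.ofHom (Ideal.Quotient.mk (Ideal.span {h}))) ≫
        hU.fromSpec := by
    rw [← Category.assoc, hcι, Category.assoc, ← IsAffineOpen.SpecMap_appLE_fromSpec f hU hW hWU,
      ← Category.assoc, ← Spec.map_comp]
  have hxhW : xh ∈ (I.subschemeCover.f ⟨W, hW⟩).opensRange := by
    rw [Scheme.IdealSheafData.opensRange_subschemeCover_map]
    exact hxW
  obtain ⟨p₀, hp₀⟩ := hxhW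
  haveI : IsOpenImmersion c :=
    @IsOpenImmersion.comp _ _ _ (Spec.map eIso.hom) (I.subschemeCover.f ⟨W, hW⟩)
      inferInstance (I.subschemeCover.map_prop ⟨W, hW⟩)
  refine ⟨c, inferInstance, Spec.map eIso.inv p₀, ?_, hcι, hc⟩
  simp only [c, Scheme.Hom.comp_apply]
  rw [← Scheme.Hom.comp_apply _ (Spec.map eIso.hom), ← Spec.map_comp, Iso.hom_inv_id,
    Spec.map_id]
  exact hp₀

end Chart

/-! ### Reducedness of the fibre -/

section Fibre

variable {X Y : Scheme.{u}} (f : X ⟶ Y) (I : X.IdealSheafData)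

/-- **The fibre of `V(I) ↪ X → Y` over `y` is reduced when, at each of its points, a local
equation of `I` is a local parameter of the fibre of `f`.** Suppose that every point `x` of
`V(I) ∩ f⁻¹(y)` lies in an affine open `W = Spec A ⊆ f⁻¹(U)`, `U ∋ y` an affine open of `Y`,
such that `I|_W = (h)` and the class `h̄` of `h` in the fibre ring `A/𝔫A` (`𝔫` the prime of `y`,
`fibreIdeal`) locally generates the prime `𝔭_x/𝔫A` (`LocallyGenerates`). Then the
scheme-theoretic fibre `V(I)_y` is reduced: its local ring at the point over `x` is
`𝒪_{V(I),x}/𝔪_y 𝒪_{V(I),x} ≅ (A/(h))_𝔔/𝔫(A/(h))_𝔔`, a field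
(`isField_locQuot_of_locallyGenerates`). This is "`H ∩ f⁻¹(y)` is a reduced scheme" for the
generic hypersurface section `H` in de Jong's proof of 4.13.
[cite: DeJong1996, Lemma 4.13 (proof), p. 70] -/
theorem isReduced_fiber_subschemeι_comp_of_locallyGenerates {y : Y}
    (H : ∀ x : X, x ∈ (I.support : Set X) → f x = y →
      ∃ (U : Y.Opens) (hU : IsAffineOpen U) (hyU : y ∈ U) (W : X.Opens) (hW : IsAffineOpen W)
        (hxW : x ∈ W) (hWU : W ≤ f ⁻¹ᵁ U) (h : Γ(X, W)),
        I.ideal ⟨W, hW⟩ = Ideal.span {h} ∧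
        LocallyGenerates ((hW.primeIdealOf ⟨x, hxW⟩).asIdeal.map
            (Ideal.Quotient.mk (fibreIdeal f hU hWU hyU)))
          (Ideal.Quotient.mk (fibreIdeal f hU hWU hyU) h)) :
    IsReduced ((I.subschemeι ≫ f).fiber y) := by
  set g := I.subschemeι ≫ f with hg
  haveI : ∀ z : ↥(g.fiber y), _root_.IsReduced ((g.fiber y).presheaf.stalk z) := by
    intro z
    -- the local ring of the fibre at `z` is `𝒪_{H, x̂} / 𝔪_y 𝒪_{H, x̂}`
    obtain ⟨e1⟩ := Literature.AlgebraicGeometry.Motives.nonempty_stalkFiber_ringEquiv g y z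
    have hgx : g (g.fiberι y z) = y := Literature.AlgebraicGeometry.Motives.apply_fiberι g y z
    set xh := g.fiberι y z with hxh
    clear_value xh
    have hfx : f (I.subschemeι xh) = y := by rw [← Scheme.Hom.comp_apply]; exact hgx
    have hxH : I.subschemeι xh ∈ (I.support : Set X) := by
      rw [← Scheme.IdealSheafData.range_subschemeι]
      exact ⟨_, rfl⟩
    obtain ⟨U, hU, hyU, W, hW, hxW, hWU, h, hIW, hloc⟩ := H _ hxH hfx
    obtain ⟨c, _, p, hcp, hcι, hc⟩ :=
      exists_chart_subscheme_of_ideal_eq_span f hU hW hWU I hIW xh hxW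
    subst hcp
    -- the primes: `𝔔 ⊂ A/(h)` of `p`, `𝔮 ⊂ A` of `x`, `𝔫 ⊂ Γ(Y, U)` of `y`
    set Φ : Γ(Y, U) ⟶ CommRingCat.of (Γ(X, W) ⧸ Ideal.span {h}) :=
      f.appLE U W hWU ≫ CommRingCat.ofHom (Ideal.Quotient.mk (Ideal.span {h})) with hΦ
    set 𝔮 : Ideal Γ(X, W) := p.asIdeal.comap (Ideal.Quotient.mk (Ideal.span {h})) with h𝔮
    haveI h𝔮p : 𝔮.IsPrime := by rw [h𝔮]; infer_instance
    have hxeq : I.subschemeι (c p) =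
        hW.fromSpec (Spec.map (CommRingCat.ofHom (Ideal.Quotient.mk (Ideal.span {h}))) p) := by
      show (c ≫ I.subschemeι) p = _
      rw [hcι]
      rfl
    have hx𝔮 : hW.primeIdealOf ⟨I.subschemeι (c p), hxW⟩ = ⟨𝔮, h𝔮p⟩ := by
      apply hW.fromSpec.isOpenEmbedding.injective
      rw [IsAffineOpen.fromSpec_primeIdealOf]
      exact hxeq
    have hy𝔫 : (hU.primeIdealOf ⟨y, hyU⟩).asIdeal = p.asIdeal.comap Φ.hom := by
      have h1 : (⟨y, hyU⟩ : U) = ⟨f (I.subschemeι (c p)), hWU hxW⟩ := Subtype.ext hfx.symm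
      rw [h1, ← IsAffineOpen.comap_primeIdealOf_appLE U hU W hW hWU hxW, hx𝔮]
      show 𝔮.comap (f.appLE U W hWU).hom = p.asIdeal.comap Φ.hom
      rw [h𝔮, Ideal.comap_comap]
      rfl
    -- the field `(A/(h))_𝔔 / 𝔫 (A/(h))_𝔔`
    have hN : (fibreIdeal f hU hWU hyU).map (Ideal.Quotient.mk (Ideal.span {h})) ≤ p.asIdeal := by
      rw [Ideal.map_le_iff_le_comap]
      change (hU.primeIdealOf ⟨y, hyU⟩).asIdeal.map (f.appLE U W hWU).hom ≤ 𝔮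
      rw [Ideal.map_le_iff_le_comap, hy𝔫, h𝔮, Ideal.comap_comap]
      rfl
    have hloc' : LocallyGenerates ((p.asIdeal.comap (Ideal.Quotient.mk (Ideal.span {h}))).map
        (Ideal.Quotient.mk (fibreIdeal f hU hWU hyU)))
        (Ideal.Quotient.mk (fibreIdeal f hU hWU hyU) h) := by
      rw [← h𝔮, ← show (hW.primeIdealOf ⟨I.subschemeι (c p), hxW⟩).asIdeal = 𝔮 by rw [hx𝔮]]
      exact hloc
    have hF := isField_locQuot_of_locallyGenerates (fibreIdeal f hU hWU hyU) h p.asIdeal hN hloc'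
    have hideal : (p.asIdeal.comap Φ.hom).map
        ((algebraMap _ (Localization.AtPrime p.asIdeal)).comp Φ.hom) =
        (fibreIdeal f hU hWU hyU).map ((algebraMap (Γ(X, W) ⧸ Ideal.span {h})
          (Localization.AtPrime p.asIdeal)).comp (Ideal.Quotient.mk (Ideal.span {h}))) := by
      rw [← hy𝔫]
      change _ = ((hU.primeIdealOf ⟨y, hyU⟩).asIdeal.map (f.appLE U W hWU).hom).map _
      rw [Ideal.map_map]
      rfl
    -- the chart computation of the local ring, and transport
    obtain ⟨e2⟩ := nonempty_stalkQuot_ringEquiv_of_chart hU Φ c g p hc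
    letI := hF.toField
    have e3 := (e1.trans e2).trans (Ideal.quotEquivOfEq hideal)
    exact isReduced_of_injective e3 e3.injective
  exact isReduced_of_isReduced_stalk _

end Fibre

end Literature.AlgebraicGeometry.Resolution

end
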